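import Summits.AtomisticToContinuum.Crystallization.Theses.ChessboardParticlePlanes
import Literature.MathematicalPhysics.StatisticalMechanics.LocalLimitOfGroundStates
import Literature.MathematicalPhysics.StatisticalMechanics.LennardJonesClusters
import Literature.MathematicalPhysics.StatisticalMechanics.CrystallizationSymmetries

/-!
# Crux PeriodicWindows (stmt-AtomisticToContinuum-3240) — ideator 1, round 1: first lemmas of two lines

Card `bounded-cell-compactness`: `CellBoundedWindows`, `IsometricMenuWindows`, the transfer stubs.
Card `recurrent-laminar-chessboard`: `IsLocalLimitOf`, `IsLaminar`, `IsUniformlyRecurrent`,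
`LaminarWindowsGeom`, `RecurrentLaminarLimit`, `RecurrentLaminarIsPeriodTwo`,
`ExactPeriodTwoMinimisersAreHcp`, `HcpLimitGivesWindows`, and the composition.
Everything is stated over existing declarations; the `sorry`s mark stubs (nothing is claimed proved
here except the two compositions, which are checked).
-/

noncomputable section

namespace Summit.AtomisticToContinuum.Crystallization.Cruxes.PeriodicWindows.IdeatorOne

open Literature.MathematicalPhysics.StatisticalMechanics
open Summit.AtomisticToContinuum.Crystallization.Theses.ChessboardParticlePlanes (PeriodicWindows)

/-- ambient space -/
abbrev E3 := EuclideanSpace ℝ (Fin 3)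

/-- the vertical unit vector `e₃` (coordinate `2`, as in the route file) -/
abbrev e3 : E3 := EuclideanSpace.single (2 : Fin 3) (1 : ℝ)

/-! ## Card 1 — bounded-cell compactness -/

/-- WINDOWWISE periodic matching with a CELL BOUND: for every sequence of LJ ground states there
is `L` such that for every `R, ε`, frequently in `N`, some translate of `x^N` is two-way
`ε`-matched on `B(0,R)` with SOME periodic configuration whose lattice of periods is spanned by
three vectors of norm `≤ L` (the periodic configuration, its orientation and its motif may depend on
`R, ε, N`). -/
def CellBoundedWindows : Prop :=
  ∀ x : (N : ℕ) → (Fin N → E3), (∀ N, IsGroundState lennardJones (x N)) →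
    ∃ L : ℝ, ∀ R ε : ℝ, 0 < ε → ∃ᶠ N in Filter.atTop, ∃ (t : E3) (P : PeriodicConfiguration 3),
      (∃ b : Fin 3 → E3, (∀ i, ‖b i‖ ≤ L) ∧ P.lattice = Submodule.span ℤ (Set.range b)) ∧
      (∀ s ∈ P.points, ‖s‖ ≤ R → ∃ i : Fin N, dist (x N i + t) s ≤ ε) ∧
      (∀ i : Fin N, ‖x N i + t‖ ≤ R → ∃ s ∈ P.points, dist (x N i + t) s ≤ ε)

/-- FINITE-MENU form (what structure theorems naturally output): a finite list of periodic
configurations such that every scale is matched, frequently, by an ISOMETRIC IMAGE of a member. -/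
def IsometricMenuWindows : Prop :=
  ∀ x : (N : ℕ) → (Fin N → E3), (∀ N, IsGroundState lennardJones (x N)) →
    ∃ (n : ℕ) (menu : Fin n → PeriodicConfiguration 3), ∀ R ε : ℝ, 0 < ε → ∃ᶠ N in Filter.atTop,
      ∃ (t : E3) (k : Fin n) (A : E3 ≃ₗᵢ[ℝ] E3),
        (∀ s ∈ ((menu k).isometryImage A).points, ‖s‖ ≤ R → ∃ i : Fin N, dist (x N i + t) s ≤ ε) ∧
        (∀ i : Fin N, ‖x N i + t‖ ≤ R → ∃ s ∈ ((menu k).isometryImage A).points,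
          dist (x N i + t) s ≤ ε)

/-- STUB (provable now; the card's first lemma): windows of `δ`-separated ground states
(`LennardJonesMinimalDistance_holds`) matched to bounded-cell periodic configurations form a
sequentially compact family whose limits are bounded-cell CRYSTALS: the matching forces the shortest
period to be `≥ δ − 2ε` (marching argument), so bases converge with `|det| ≥ c δ³` to a full-rank
`ZSpan` lattice `Λ∞`; the windows converge locally (`exists_subseq_forall_eventually_ballMatch`) to a
`δ`-separated `Λ∞`-invariant `X = F + Λ∞`, the point set of ONE `PeriodicConfiguration 3` (motif =
representatives of `X`, NOT the limit of the motifs, which may carry doubled sites); a diagonal over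
`(R, ε) = (j, 1/j)` along the `∃ᶠ N` sets gives the crux's clause. -/
theorem stub_cellCompactness : CellBoundedWindows → PeriodicWindows := by
  sorry

/-- STUB (provable now): the converse — a fixed `P` has some basis; so the crux IS the cell bound. -/
theorem stub_cellBounded_of_periodicWindows : PeriodicWindows → CellBoundedWindows := by
  sorry

/-- STUB (provable now): isometric images of finitely many periodic configurations have uniformly
bounded bases (`‖A b‖ = ‖b‖`). -/
theorem stub_menu_cellBounded : IsometricMenuWindows → CellBoundedWindows := by
  sorry

/-- composition (checked) -/
theorem periodicWindows_of_menu (h₁ : IsometricMenuWindows → CellBoundedWindows)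
    (h₂ : CellBoundedWindows → PeriodicWindows) : IsometricMenuWindows → PeriodicWindows :=
  fun h => h₂ (h₁ h)

/-! ## Card 2 — the chessboard in a uniformly recurrent laminar local limit -/

/-- `X` is a local limit of translates of THE GIVEN sequence `x` (the hull `Ω(x)`; compare
`IsLocalLimitOfGroundStates`, which quantifies the ground states existentially). -/
def IsLocalLimitOf (x : (N : ℕ) → (Fin N → E3)) (X : Set E3) : Prop :=
  ∃ (σ : ℕ → ℕ) (τ : ℕ → E3), StrictMono σ ∧ ∀ R ε : ℝ, 0 < ε → ∀ᶠ j in Filter.atTop,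
    BallMatch ε R 0 (Set.range fun i => x (σ j) i + τ j) X

/-- exactly laminar in the vertical coordinate: occupied heights pairwise `≥ 3/4` apart -/
def IsLaminar (X : Set E3) : Prop :=
  ∀ p ∈ X, ∀ q ∈ X, p 2 ≠ q 2 → (3 : ℝ) / 4 ≤ |p 2 - q 2|

/-- uniformly recurrent (almost periodic) in the local rubber topology: every `r`-pattern of `X`
reappears, up to `ε`, within distance `G(r, ε)` of every point of space -/
def IsUniformlyRecurrent (X : Set E3) : Prop :=
  ∀ r ε : ℝ, 0 < ε → ∃ G : ℝ, ∀ c c' : E3, ∃ v : E3, ‖v‖ ≤ G ∧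
    BallMatch ε r 0 ((fun p => p - c) '' X) ((fun p => p - (c' + v)) '' X)

/-- vertical period two with equally spaced planes (the period-2-stack format of `LjBilayerHcp`) -/
def IsPeriodTwoStack (X : Set E3) : Prop :=
  ∃ t h : ℝ, (3 : ℝ) / 4 ≤ h ∧ (∀ p ∈ X, ∃ k : ℤ, p 2 = t + h * (k : ℝ)) ∧
    (∀ p ∈ X, p + (2 * h) • e3 ∈ X ∧ p - (2 * h) • e3 ∈ X)

/-- INPUT (the geometric part of crux `LjLaminarWindows` 6711 — its energy clause is NOT used):
laminar, 7/10-separated windows of every size, frequently, up to a rotation. -/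
def LaminarWindowsGeom : Prop :=
  ∃ ρ₀ : ℝ, ∀ x : (N : ℕ) → (Fin N → E3), (∀ N, IsGroundState lennardJones (x N)) → ∀ η : ℝ, 0 < η →
    ∃ L₀ : ℝ, ∀ L : ℝ, L₀ ≤ L → ∃ᶠ N in Filter.atTop, ∃ (i : Fin N) (A : E3 →ₗᵢ[ℝ] E3) (T : Set ℝ),
      (∀ t ∈ T, ∀ t' ∈ T, t ≠ t' → (3 : ℝ) / 4 ≤ |t - t'|) ∧
      (∀ j k : Fin N, j ≠ k → dist (x N j) (x N i) ≤ L → dist (x N k) (x N i) ≤ L →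
        (7 : ℝ) / 10 ≤ dist (x N j) (x N k)) ∧
      (∀ j : Fin N, dist (x N j) (x N i) ≤ L → ∃ t ∈ T, |(A (x N j - x N i)) 2 - t| ≤ η) ∧
      (∀ c : E3, dist c (x N i) ≤ L - ρ₀ → ∃ j : Fin N, dist (x N j) c ≤ ρ₀)

/-- SOFT STUB S1+S2 (compactness + Zorn/Auslander; provable now): laminar windows at every scale give,
after one fixed rotation of the whole ground-state sequence, a RELATIVELY DENSE, exactly laminar,
7/10-separated, UNIFORMLY RECURRENT local limit (extract a laminar limit by
`exists_subseq_forall_eventually_ballMatch` + `O(3)` compactness; its orbit closure inside `Ω(x)` is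
compact invariant, a minimal subset exists, its points are uniformly recurrent and still laminar,
separated, non-empty by relative density of limits of 7/10-separated windows with bounded gaps —
gaps are bounded because site energies are two-sided surface-exact, see the card). -/
def RecurrentLaminarLimit : Prop :=
  ∀ ρ₀ : ℝ, ∀ x : (N : ℕ) → (Fin N → E3), (∀ N, IsGroundState lennardJones (x N)) →
    (∀ η : ℝ, 0 < η → ∃ L₀ : ℝ, ∀ L : ℝ, L₀ ≤ L → ∃ᶠ N in Filter.atTop,
      ∃ (i : Fin N) (A : E3 →ₗᵢ[ℝ] E3) (T : Set ℝ),
        (∀ t ∈ T, ∀ t' ∈ T, t ≠ t' → (3 : ℝ) / 4 ≤ |t - t'|) ∧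
        (∀ j k : Fin N, j ≠ k → dist (x N j) (x N i) ≤ L → dist (x N k) (x N i) ≤ L →
          (7 : ℝ) / 10 ≤ dist (x N j) (x N k)) ∧
        (∀ j : Fin N, dist (x N j) (x N i) ≤ L → ∃ t ∈ T, |(A (x N j - x N i)) 2 - t| ≤ η) ∧
        (∀ c : E3, dist c (x N i) ≤ L - ρ₀ → ∃ j : Fin N, dist (x N j) c ≤ ρ₀)) →
    ∃ (A : E3 ≃ₗᵢ[ℝ] E3) (X : Set E3), IsLocalLimitOf (fun N i => A (x N i)) X ∧
      (∀ c : E3, ∃ p ∈ X, dist p c ≤ ρ₀) ∧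
      IsLaminar X ∧ (∀ p ∈ X, ∀ q ∈ X, p ≠ q → (7 : ℝ) / 10 ≤ dist p q) ∧ IsUniformlyRecurrent X

/-- THE LEVER (stub S3): in a uniformly recurrent, exactly laminar local limit of LJ ground states the
chessboard sum-form is an EQUALITY at density level, so every layer triple is a mirror triple:
the limit is a period-2 stack. -/
def RecurrentLaminarIsPeriodTwo : Prop :=
  ∀ x : (N : ℕ) → (Fin N → E3), (∀ N, IsGroundState lennardJones (x N)) → ∀ X : Set E3,
    IsLocalLimitOf x X → (∃ ρ₀ : ℝ, ∀ c : E3, ∃ p ∈ X, dist p c ≤ ρ₀) → IsLaminar X →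
    (∀ p ∈ X, ∀ q ∈ X, p ≠ q → (7 : ℝ) / 10 ≤ dist p q) → IsUniformlyRecurrent X →
    IsPeriodTwoStack X

/-- STUB S4 (the residual planar problem in EXACT form — weaker than coercivity of the bilayer
functional): a uniformly recurrent period-2 laminar local limit of LJ ground states is a rigid image of
relaxed hcp. -/
def ExactPeriodTwoMinimisersAreHcp : Prop :=
  ∀ x : (N : ℕ) → (Fin N → E3), (∀ N, IsGroundState lennardJones (x N)) → ∀ X : Set E3,
    IsLocalLimitOf x X → (∃ ρ₀ : ℝ, ∀ c : E3, ∃ p ∈ X, dist p c ≤ ρ₀) →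
    (∀ p ∈ X, ∀ q ∈ X, p ≠ q → (7 : ℝ) / 10 ≤ dist p q) → IsUniformlyRecurrent X →
    IsPeriodTwoStack X →
    ∃ (a h : ℝ) (ha : a ≠ 0) (hh : h ≠ 0) (A : E3 ≃ₗᵢ[ℝ] E3) (τ : E3),
      X = (fun p => A p + τ) '' (hcpPeriodicConfiguration ha hh).points

/-- SOFT STUB S5 (provable now): a periodic local limit of (a rotation of) the sequence is matched
frequently — membership in `Ω(x)` IS the crux's matching clause, rotated back by
`PeriodicConfiguration.isometryImage`. -/
def HcpLimitGivesWindows : Prop :=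
  ∀ x : (N : ℕ) → (Fin N → E3), (∀ N, IsGroundState lennardJones (x N)) →
    (∃ (A : E3 ≃ₗᵢ[ℝ] E3) (X : Set E3) (P : PeriodicConfiguration 3) (B : E3 ≃ₗᵢ[ℝ] E3) (τ : E3),
      IsLocalLimitOf (fun N i => A (x N i)) X ∧ X = (fun p => B p + τ) '' P.points) →
    ∃ P : PeriodicConfiguration 3, ∀ R ε : ℝ, 0 < ε → ∃ᶠ N in Filter.atTop, ∃ t : E3,
      (∀ s ∈ P.points, ‖s‖ ≤ R → ∃ i : Fin N, dist (x N i + t) s ≤ ε) ∧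
      (∀ i : Fin N, ‖x N i + t‖ ≤ R → ∃ s ∈ P.points, dist (x N i + t) s ≤ ε)

/-! ### Variant without minimality: hull-exactification (zero density of non-mirror triples ⇒ an
exactly period-2 element of `Ω(x)`), which the unit-weight deficit bookkeeping of the Dirichlet
chessboard makes available with CRUDE periodic approximants (see the card's ARITHMETIC bullet). -/

/-- SOFT STUB S1' (compactness only, provable now): a dense, exactly laminar, separated local limit
after one rotation. -/
def LaminarLimit : Prop :=
  ∀ ρ₀ : ℝ, ∀ x : (N : ℕ) → (Fin N → E3), (∀ N, IsGroundState lennardJones (x N)) →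
    (∀ η : ℝ, 0 < η → ∃ L₀ : ℝ, ∀ L : ℝ, L₀ ≤ L → ∃ᶠ N in Filter.atTop,
      ∃ (i : Fin N) (A : E3 →ₗᵢ[ℝ] E3) (T : Set ℝ),
        (∀ t ∈ T, ∀ t' ∈ T, t ≠ t' → (3 : ℝ) / 4 ≤ |t - t'|) ∧
        (∀ j k : Fin N, j ≠ k → dist (x N j) (x N i) ≤ L → dist (x N k) (x N i) ≤ L →
          (7 : ℝ) / 10 ≤ dist (x N j) (x N k)) ∧
        (∀ j : Fin N, dist (x N j) (x N i) ≤ L → ∃ t ∈ T, |(A (x N j - x N i)) 2 - t| ≤ η) ∧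
        (∀ c : E3, dist c (x N i) ≤ L - ρ₀ → ∃ j : Fin N, dist (x N j) c ≤ ρ₀)) →
    ∃ (A : E3 ≃ₗᵢ[ℝ] E3) (X : Set E3), IsLocalLimitOf (fun N i => A (x N i)) X ∧
      (∀ c : E3, ∃ p ∈ X, dist p c ≤ ρ₀) ∧
      IsLaminar X ∧ (∀ p ∈ X, ∀ q ∈ X, p ≠ q → (7 : ℝ) / 10 ≤ dist p q)

/-- THE LEVER, exactified form (stub S3'): the laminar part of the hull of a ground-state sequence,
if non-empty, contains a PERIOD-2 STACK (chessboard sum-form with unit-weight single-plane deficits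
on crude box approximants ⇒ zero volume density of non-mirror triples ⇒ clean balls ⇒ limit). -/
def LaminarHullHasPeriodTwoPoint : Prop :=
  ∀ x : (N : ℕ) → (Fin N → E3), (∀ N, IsGroundState lennardJones (x N)) → ∀ X : Set E3,
    IsLocalLimitOf x X → (∃ ρ₀ : ℝ, ∀ c : E3, ∃ p ∈ X, dist p c ≤ ρ₀) → IsLaminar X →
    (∀ p ∈ X, ∀ q ∈ X, p ≠ q → (7 : ℝ) / 10 ≤ dist p q) →
    ∃ X' : Set E3, IsLocalLimitOf x X' ∧ (∃ ρ₁ : ℝ, ∀ c : E3, ∃ p ∈ X', dist p c ≤ ρ₁) ∧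
      (∀ p ∈ X', ∀ q ∈ X', p ≠ q → (7 : ℝ) / 10 ≤ dist p q) ∧ IsLaminar X' ∧ IsPeriodTwoStack X'

/-- STUB S4' (exactified planar step): the period-2 part of the hull, if non-empty, contains a rigid
image of relaxed hcp. -/
def PeriodTwoHullHasHcpPoint : Prop :=
  ∀ x : (N : ℕ) → (Fin N → E3), (∀ N, IsGroundState lennardJones (x N)) → ∀ X : Set E3,
    IsLocalLimitOf x X → (∃ ρ₀ : ℝ, ∀ c : E3, ∃ p ∈ X, dist p c ≤ ρ₀) →
    (∀ p ∈ X, ∀ q ∈ X, p ≠ q → (7 : ℝ) / 10 ≤ dist p q) → IsLaminar X → IsPeriodTwoStack X →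
    ∃ (X'' : Set E3) (a h : ℝ) (ha : a ≠ 0) (hh : h ≠ 0) (A : E3 ≃ₗᵢ[ℝ] E3) (τ : E3),
      IsLocalLimitOf x X'' ∧ X'' = (fun p => A p + τ) '' (hcpPeriodicConfiguration ha hh).points

/-- Rotated ground states are ground states (isometry invariance, in tree). -/
theorem isGroundState_rotate (A : E3 ≃ₗᵢ[ℝ] E3) {N : ℕ} {y : Fin N → E3}
    (hy : IsGroundState lennardJones y) : IsGroundState lennardJones (fun i => A (y i)) :=
  (isGroundState_comp_isometry_iff lennardJones A.isometry (x := y)).2 hy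

/-- COMPOSITION (checked, no sorry): the five stubs give the crux BY NAME. -/
theorem periodicWindows_of (h0 : LaminarWindowsGeom) (h12 : RecurrentLaminarLimit)
    (h3 : RecurrentLaminarIsPeriodTwo) (h4 : ExactPeriodTwoMinimisersAreHcp)
    (h5 : HcpLimitGivesWindows) : PeriodicWindows := by
  intro x hx
  obtain ⟨ρ₀, h0'⟩ := h0
  obtain ⟨A, X, hX, hdense, hlam, hsep, hrec⟩ := h12 ρ₀ x hx (h0' x hx)
  have hxA : ∀ N, IsGroundState lennardJones ((fun N i => A (x N i)) N) :=
    fun N => isGroundState_rotate A (hx N)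
  have hne : ∃ ρ₀ : ℝ, ∀ c : E3, ∃ p ∈ X, dist p c ≤ ρ₀ := ⟨ρ₀, hdense⟩
  have h2 : IsPeriodTwoStack X := h3 _ hxA X hX hne hlam hsep hrec
  obtain ⟨a, h, ha, hh, B, τ, hXeq⟩ := h4 _ hxA X hX hne hsep hrec h2
  exact h5 x hx ⟨A, X, hcpPeriodicConfiguration ha hh, B, τ, hX, hXeq⟩

/-- COMPOSITION, exactified variant (checked, no sorry): no minimality anywhere. -/
theorem periodicWindows_of' (h0 : LaminarWindowsGeom) (h1 : LaminarLimit)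
    (h3 : LaminarHullHasPeriodTwoPoint) (h4 : PeriodTwoHullHasHcpPoint)
    (h5 : HcpLimitGivesWindows) : PeriodicWindows := by
  intro x hx
  obtain ⟨ρ₀, h0'⟩ := h0
  obtain ⟨A, X, hX, hdense, hlam, hsep⟩ := h1 ρ₀ x hx (h0' x hx)
  have hxA : ∀ N, IsGroundState lennardJones ((fun N i => A (x N i)) N) :=
    fun N => isGroundState_rotate A (hx N)
  obtain ⟨X', hX', hdense', hsep', hlam', h2'⟩ := h3 _ hxA X hX ⟨ρ₀, hdense⟩ hlam hsep
  obtain ⟨X'', a, h, ha, hh, B, τ, hX'', hXeq⟩ := h4 _ hxA X' hX' hdense' hsep' hlam' h2'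
  exact h5 x hx ⟨A, X'', hcpPeriodicConfiguration ha hh, B, τ, hX'', hXeq⟩

end Summit.AtomisticToContinuum.Crystallization.Cruxes.PeriodicWindows.IdeatorOne

end
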